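import Literature.NumberTheory.Automorphic.GLnHeckeOperatorT
import Literature.NumberTheory.Automorphic.GLnLocalHeckeRingIntegralGenerators
import HarnessLib

/-!
# `t(p^m) = ∑_{a ≤ b, a + b = m} (diag(p^a, p^b))_Λ` and `T(1, p^{m+2}) = T(p^{m+2}) - T(p, p) T(p^m)`
# (Andrianov–Zhuravlev Ch. 3 (2.10) for `n = 2`; Shimura Thm. 3.24 (1), (2))

Topic `NumberTheory/Automorphic`; namespaces `Literature.NumberTheory.Automorphic` and `….heckeAlgebra` (lane
`lit-hodgefound`, Track 2 foundations; seat `lit-hodgefound-p11`, generation 39, row g39-#11).  THEOREMS ONLY: no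
definition, no named fact, no instance, no notation.

## Source, as printed

Andrianov–Zhuravlev, *Modular Forms and Hecke Operators* (1995), Ch. 3 §2.2 (2.9)–(2.10) (PDF p. 111): the
elements `t(m) = ∑_{g ∈ ED_n(m)} (g)`, where `ED_n(m)` is the set of elementary-divisor matrices
`diag(d_1, …, d_n)`, `d_i > 0`, `d_i | d_{i+1}`, `∏ d_i = m`; for `n = 2` and `m = p^δ` these are the
`diag(p^a, p^b)`, `0 ≤ a ≤ b`, `a + b = δ` (cf. Problem 2.11: `Z_p(v_1, v_2) = ∑_{0 ≤ δ_1 ≤ δ_2} (diag(p^{δ_1},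
p^{δ_2}))_Λ v_1^{δ_1} v_2^{δ_2}`).  Shimura, *Introduction to the Arithmetic Theory of Automorphic Functions* (1971),
§3.3 THEOREM 3.24 (`n = 2`, `p` prime): «(1) `T(m) = ∑_{ad=m, a|d} T(a, d)`.  (2) `T(1, p^k) = T(p^k) - T(p, p)
T(p^{k-2})` (`k ≥ 2`)», with Prop. 3.17: `T(c, …, c) T(b_1, …, b_n) = T(cb_1, …, cb_n)`.

## What is formalised (theorems only)

* §1 (general `n`): the prime-power diagonal matrices `diag(p^{f_1}, …, p^{f_n})` lie in `M_n(±p^{∑ f_i})`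
  (`integral_absdet_diagonalGL_primePow`), non-decreasing exponents are recovered from the double coset
  (`eq_of_orbit_diagonalGL_primePow_eq`), and `pE_n · diag(p^{f_i}) = diag(p^{f_i + 1})` (`pScalar_mul_diagonalGL_primePow`);
* §2 (`n = 2`): **`heckeAlgebra.tOperator_prime_pow_eq_sum_doubleCosetOperator`** — (2.10) / THM 3.24 (1) at `p^m`:
  `t(p^m) = ∑_{a=0}^{⌊m/2⌋} (diag(p^a, p^{m-a}))_Λ`;
  **`heckeAlgebra.tOperator_prime_pow_succ_succ_eq`** — THM 3.24 (2), additively: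
  `t(p^{m+2}) = (diag(1, p^{m+2}))_Λ + (pE_2)_Λ · t(p^m)`; and `heckeAlgebra.doubleCosetOperator_diagonalGL_primePow_succ`
  (`(diag(p^{a+1}, p^{b+1}))_Λ = (pE_2)_Λ (diag(p^a, p^b))_Λ`, Prop. 3.17).

## References
* [AndrianovZhuravlev1995] A. N. Andrianov, V. G. Zhuravlev, *Modular Forms and Hecke Operators*, Transl. Math.
  Monogr. 145, AMS (1995), Ch. 3 §2.2 Lemma 2.2, (2.9)–(2.10), Lemma 2.4, Problem 2.11 (PDF pp. 111–115).
* [ShimuraIATAF1971] G. Shimura, *Introduction to the Arithmetic Theory of Automorphic Functions*, Publ. Math. Soc.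
  Japan 11 (1971), §3.2 Prop. 3.17, §3.3 Thm. 3.24 (1), (2).
-/

noncomputable section

open scoped MatrixGroups

open MulAction

namespace Literature.NumberTheory.Automorphic

/-! ## §1 Prime-power diagonal matrices `diag(p^{f_1}, …, p^{f_n})` -/

section Diagonal

variable {n : ℕ} {p : ℕ}

/-- The matrix of `diag(p^{f_1}, …, p^{f_n})`. [cite: AndrianovZhuravlev1995, Ch. 3 §2.2 (2.9)] -/
theorem coe_diagonalGL_primePow (hp : p.Prime) (f : Fin n → ℕ) :
    ((diagonalGL (Fin n) ℚ fun i => Units.mk0 ((p : ℚ) ^ f i) (pow_ne_zero _ (Nat.cast_ne_zero.mpr hp.ne_zero)) :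
        GL (Fin n) ℚ) : Matrix (Fin n) (Fin n) ℚ) = Matrix.diagonal fun i => ((p ^ f i : ℕ) : ℚ) := by
  rw [coe_diagonalGL]
  congr 1
  funext i
  rw [Units.val_mk0, Nat.cast_pow]

/-- **`diag(p^{f_1}, …, p^{f_n}) ∈ M_n(±p^{∑ f_i})`** (the elementary-divisor matrices (2.9) of a prime power).
[cite: AndrianovZhuravlev1995, Ch. 3 §2.2 (2.9)] -/
theorem integral_absdet_diagonalGL_primePow (hp : p.Prime) (f : Fin n → ℕ) :
    (∀ i j, ∃ m : ℤ, ((diagonalGL (Fin n) ℚ fun i => Units.mk0 ((p : ℚ) ^ f i)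
        (pow_ne_zero _ (Nat.cast_ne_zero.mpr hp.ne_zero)) : GL (Fin n) ℚ) : Matrix (Fin n) (Fin n) ℚ) i j = m) ∧
      |((diagonalGL (Fin n) ℚ fun i => Units.mk0 ((p : ℚ) ^ f i)
        (pow_ne_zero _ (Nat.cast_ne_zero.mpr hp.ne_zero)) : GL (Fin n) ℚ) : Matrix (Fin n) (Fin n) ℚ).det| =
        (p ^ ∑ i, f i : ℕ) := by
  have h := integral_absdet_of_coe_eq_diagonal (coe_diagonalGL_primePow hp f)
  rwa [Finset.prod_pow_eq_pow_sum] at h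

/-- **Non-decreasing exponents are determined by the double coset**: if `Λ diag(p^{f_i}) Λ = Λ diag(p^{f'_i}) Λ` with
`f, f'` non-decreasing then `f = f'` (uniqueness of elementary divisors, Lemma 2.2).
[cite: AndrianovZhuravlev1995, Ch. 3 §2.2 Lemma 2.2] -/
theorem eq_of_orbit_diagonalGL_primePow_eq (hp : p.Prime) {f f' : Fin n → ℕ} (hf : ∀ i j, i ≤ j → f i ≤ f j)
    (hf' : ∀ i j, i ≤ j → f' i ≤ f' j)
    (h : orbit (Matrix.GeneralLinearGroup.map (n := Fin n) (Int.castRingHom ℚ)).range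
        ((diagonalGL (Fin n) ℚ fun i => Units.mk0 ((p : ℚ) ^ f i)
          (pow_ne_zero _ (Nat.cast_ne_zero.mpr hp.ne_zero)) : GL (Fin n) ℚ) :
          GL (Fin n) ℚ ⧸ (Matrix.GeneralLinearGroup.map (n := Fin n) (Int.castRingHom ℚ)).range) =
      orbit (Matrix.GeneralLinearGroup.map (n := Fin n) (Int.castRingHom ℚ)).range
        ((diagonalGL (Fin n) ℚ fun i => Units.mk0 ((p : ℚ) ^ f' i)
          (pow_ne_zero _ (Nat.cast_ne_zero.mpr hp.ne_zero)) : GL (Fin n) ℚ) :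
          GL (Fin n) ℚ ⧸ (Matrix.GeneralLinearGroup.map (n := Fin n) (Int.castRingHom ℚ)).range)) :
    f = f' := by
  have he := natChain_eq_of_orbit_mk_eq (e := fun i => p ^ f i) (f := fun i => p ^ f' i)
    (fun i => pow_pos hp.pos _) (fun i => pow_pos hp.pos _) (fun i j hij => pow_dvd_pow p (hf i j hij))
    (fun i j hij => pow_dvd_pow p (hf' i j hij)) (coe_diagonalGL_primePow hp f) (coe_diagonalGL_primePow hp f') h
  funext i
  exact Nat.pow_right_injective hp.two_le (congr_fun he i)

/-- **`pE_n · diag(p^{f_i}) = diag(p^{f_i + 1})`** (Lemma 2.4: `g = g_0 (dE_n)`).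
[cite: AndrianovZhuravlev1995, Ch. 3 §2.2 Lemma 2.4] [cite: ShimuraIATAF1971, §3.2 Prop. 3.17] -/
theorem pScalar_mul_diagonalGL_primePow (hp : p.Prime) (f : Fin n → ℕ) :
    (diagonalGL (Fin n) ℚ fun _ => Units.mk0 (p : ℚ) (Nat.cast_ne_zero.mpr hp.pos.ne')) *
        (diagonalGL (Fin n) ℚ fun i => Units.mk0 ((p : ℚ) ^ f i) (pow_ne_zero _ (Nat.cast_ne_zero.mpr hp.ne_zero))) =
      diagonalGL (Fin n) ℚ fun i => Units.mk0 ((p : ℚ) ^ (f i + 1)) (pow_ne_zero _ (Nat.cast_ne_zero.mpr hp.ne_zero)) := by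
  rw [← map_mul]
  congr 1
  funext i
  rw [Pi.mul_apply]
  ext
  rw [Units.val_mul, Units.val_mk0, Units.val_mk0, Units.val_mk0, pow_succ, mul_comm]

end Diagonal

/-! ## §2 `n = 2`: `t(p^m)` as a sum of double cosets, and `T(1, p^{m+2})` -/

namespace heckeAlgebra

section GL2

variable (k : Type*) [CommRing k] {p : ℕ}

/-- `![a, b]` is non-decreasing iff `a ≤ b`. [folklore] -/
private theorem monotone_vecCons_two {a b : ℕ} (h : a ≤ b) : ∀ i j : Fin 2, i ≤ j → (![a, b] : Fin 2 → ℕ) i ≤ ![a, b] j := by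
  intro i j hij
  fin_cases i <;> fin_cases j <;> simp at hij ⊢
  exact h

/-- **ANDRIANOV–ZHURAVLEV (2.10) for `n = 2` at a prime power / SHIMURA THM 3.24 (1):
`t(p^m) = ∑_{a=0}^{⌊m/2⌋} (diag(p^a, p^{m-a}))_Λ`** — the double cosets in `M_2(±p^m)` are those of the
elementary-divisor matrices `diag(p^a, p^b)`, `a ≤ b`, `a + b = m`, each exactly once («`T(m) = ∑_{ad=m, a|d} T(a, d)`»).
[cite: AndrianovZhuravlev1995, Ch. 3 §2.2 (2.9)–(2.10), Lemma 2.2] [cite: ShimuraIATAF1971, §3.3 Thm. 3.24 (1)] -/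
theorem tOperator_prime_pow_eq_sum_doubleCosetOperator (hp : p.Prime) (m : ℕ) :
    tOperator k 2 (p ^ m) = ∑ a ∈ Finset.range (m / 2 + 1),
      haveI := isHeckeTriple_glnInt_glnRat (Fin 2)
      doubleCosetOperator (k := k) (Matrix.GeneralLinearGroup.map (n := Fin 2) (Int.castRingHom ℚ)).range
        (diagonalGL (Fin 2) ℚ fun i => Units.mk0 ((p : ℚ) ^ (![a, m - a] : Fin 2 → ℕ) i)
          (pow_ne_zero _ (Nat.cast_ne_zero.mpr hp.ne_zero))) := by
  classical
  haveI := isHeckeTriple_glnInt_glnRat (Fin 2)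
  have hp' : (p : ℚ) ≠ 0 := Nat.cast_ne_zero.mpr hp.ne_zero
  -- the representatives `D a = diag(p^a, p^{m-a})`, `a ≤ m/2`
  set D : ℕ → GL (Fin 2) ℚ := fun a => diagonalGL (Fin 2) ℚ fun i => Units.mk0 ((p : ℚ) ^ (![a, m - a] : Fin 2 → ℕ) i)
    (pow_ne_zero _ (Nat.cast_ne_zero.mpr hp.ne_zero)) with hD
  have hDmem : ∀ a, a ≤ m → (∀ i j, ∃ z : ℤ, ((D a : GL (Fin 2) ℚ) : Matrix (Fin 2) (Fin 2) ℚ) i j = z) ∧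
      |((D a : GL (Fin 2) ℚ) : Matrix (Fin 2) (Fin 2) ℚ).det| = (p ^ m : ℕ) := by
    intro a ha
    have h := integral_absdet_diagonalGL_primePow (n := 2) hp (![a, m - a] : Fin 2 → ℕ)
    rwa [Fin.sum_univ_two, Matrix.cons_val_zero, Matrix.cons_val_one, Matrix.cons_val_fin_one,
      Nat.add_sub_cancel' ha] at h
  have hle : ∀ a ∈ Finset.range (m / 2 + 1), a ≤ m - a := by
    intro a ha
    have h2 : a * 2 ≤ m := (Nat.le_div_iff_mul_le two_pos).1 (Nat.lt_succ_iff.1 (Finset.mem_range.1 ha))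
    omega
  have hinjD : ∀ a a' : ℕ, D a = D a' → a = a' := by
    intro a a' h
    have h00 := congr_fun (congr_fun (congr_arg (fun g : GL (Fin 2) ℚ => (g : Matrix (Fin 2) (Fin 2) ℚ)) h) 0) 0
    simp only [hD, coe_diagonalGL, Matrix.diagonal_apply_eq, Units.val_mk0, Matrix.cons_val_zero] at h00
    exact Nat.pow_right_injective hp.two_le (by exact_mod_cast h00)
  rw [← Finset.sum_image fun a _ a' _ h => hinjD a a' h]
  refine tOperator_eq_sum_doubleCosetOperator k 2 _ (fun g hg => ?_) (fun g hg g' hg' h => ?_) (fun x hx => ?_)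
  · -- representatives lie in `M_2(±p^m)`
    obtain ⟨a, ha, rfl⟩ := Finset.mem_image.1 hg
    exact hDmem a (by have := hle a ha; omega)
  · -- distinct representatives give distinct double cosets
    obtain ⟨a, ha, rfl⟩ := Finset.mem_image.1 hg
    obtain ⟨a', ha', rfl⟩ := Finset.mem_image.1 hg'
    have hf := eq_of_orbit_diagonalGL_primePow_eq (n := 2) hp (monotone_vecCons_two (hle a ha))
      (monotone_vecCons_two (hle a' ha')) h
    have h0 := congr_fun hf 0
    simp only [Matrix.cons_val_zero] at h0
    rw [h0]
  · -- every `x ∈ M_2(±p^m)` lies in the double coset of some `diag(p^a, p^{m-a})` (elementary divisors)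
    obtain ⟨γ, hγ, δ, hδ, e, he, hch, hdiag, hprod⟩ := exists_glnInt_mul_mul_eq_diagonal_natChain x hx
    obtain ⟨κ, hκ, heκ⟩ := natChain_eq_prime_pow hp hch hprod
    have hsum : κ 0 + κ 1 = m := by
      apply Nat.pow_right_injective hp.two_le
      simp only
      rw [pow_add, ← heκ 0, ← heκ 1, ← hprod, Fin.prod_univ_two]
    have hκ0 : κ 0 ≤ m - κ 0 := by have := hκ 0 1 (by decide); omega
    refine ⟨D (κ 0), Finset.mem_image.2 ⟨κ 0, Finset.mem_range.2 (Nat.lt_succ_iff.2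
      ((Nat.le_div_iff_mul_le two_pos).2 (by omega))), rfl⟩, ?_⟩
    have hxD : γ * x * δ = D (κ 0) := by
      refine Units.ext ?_
      rw [hdiag, hD, coe_diagonalGL]
      congr 1
      funext i
      rw [Units.val_mk0]
      fin_cases i
      · simp [heκ 0]
      · simp [heκ 1, ← hsum]
    exact MulAction.orbit_eq_iff.1 ((orbit_mk_eq_orbit_mk_iff _ x (D (κ 0))).2 ⟨γ, hγ, δ, hδ, hxD⟩)

/-- **`(diag(p^{a+1}, p^{b+1}))_Λ = (pE_2)_Λ · (diag(p^a, p^b))_Λ`** (Prop. 3.17: `T(c, c) T(b_1, b_2) = T(cb_1, cb_2)`;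
Lemma 2.4). [cite: ShimuraIATAF1971, §3.2 Prop. 3.17] [cite: AndrianovZhuravlev1995, Ch. 3 §2.2 Lemma 2.4] -/
theorem doubleCosetOperator_diagonalGL_primePow_succ (hp : p.Prime) (f : Fin 2 → ℕ) :
    haveI := isHeckeTriple_glnInt_glnRat (Fin 2)
    doubleCosetOperator (k := k) (Matrix.GeneralLinearGroup.map (n := Fin 2) (Int.castRingHom ℚ)).range
        (diagonalGL (Fin 2) ℚ fun i => Units.mk0 ((p : ℚ) ^ (f i + 1)) (pow_ne_zero _ (Nat.cast_ne_zero.mpr hp.ne_zero))) =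
      doubleCosetOperator (k := k) (Matrix.GeneralLinearGroup.map (n := Fin 2) (Int.castRingHom ℚ)).range
          (diagonalGL (Fin 2) ℚ fun _ => Units.mk0 (p : ℚ) (Nat.cast_ne_zero.mpr hp.pos.ne')) *
        doubleCosetOperator (k := k) (Matrix.GeneralLinearGroup.map (n := Fin 2) (Int.castRingHom ℚ)).range
          (diagonalGL (Fin 2) ℚ fun i => Units.mk0 ((p : ℚ) ^ f i) (pow_ne_zero _ (Nat.cast_ne_zero.mpr hp.ne_zero))) := by
  haveI := isHeckeTriple_glnInt_glnRat (Fin 2)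
  rw [doubleCosetOperator_central_mul _ (pScalar_comm hp.pos), pScalar_mul_diagonalGL_primePow hp f]

/-- **SHIMURA THEOREM 3.24 (2), additively: `t(p^{m+2}) = (diag(1, p^{m+2}))_Λ + (pE_2)_Λ · t(p^m)`**
(«`T(1, p^k) = T(p^k) - T(p, p) T(p^{k-2})` (`k ≥ 2`)»): split off the term `a = 0` of
`tOperator_prime_pow_eq_sum_doubleCosetOperator` and factor `pE_2` from the others.
[cite: ShimuraIATAF1971, §3.3 Thm. 3.24 (2)] [cite: AndrianovZhuravlev1995, Ch. 3 §2.2 (2.10), Lemma 2.4] -/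
theorem tOperator_prime_pow_succ_succ_eq (hp : p.Prime) (m : ℕ) :
    tOperator k 2 (p ^ (m + 2)) =
      (haveI := isHeckeTriple_glnInt_glnRat (Fin 2);
        doubleCosetOperator (k := k) (Matrix.GeneralLinearGroup.map (n := Fin 2) (Int.castRingHom ℚ)).range
          (diagonalGL (Fin 2) ℚ fun i => Units.mk0 ((p : ℚ) ^ (![0, m + 2] : Fin 2 → ℕ) i)
            (pow_ne_zero _ (Nat.cast_ne_zero.mpr hp.ne_zero)))) +
      (haveI := isHeckeTriple_glnInt_glnRat (Fin 2);
        doubleCosetOperator (k := k) (Matrix.GeneralLinearGroup.map (n := Fin 2) (Int.castRingHom ℚ)).range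
          (diagonalGL (Fin 2) ℚ fun _ => Units.mk0 (p : ℚ) (Nat.cast_ne_zero.mpr hp.pos.ne'))) *
        tOperator k 2 (p ^ m) := by
  haveI := isHeckeTriple_glnInt_glnRat (Fin 2)
  rw [tOperator_prime_pow_eq_sum_doubleCosetOperator k hp (m + 2), tOperator_prime_pow_eq_sum_doubleCosetOperator k hp m,
    show (m + 2) / 2 + 1 = m / 2 + 1 + 1 by omega, Finset.sum_range_succ', Nat.sub_zero, add_comm, Finset.mul_sum]
  congr 1
  refine Finset.sum_congr rfl fun a ha => ?_
  have hle : a ≤ m := by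
    have h2 : a * 2 ≤ m := (Nat.le_div_iff_mul_le two_pos).1 (Nat.lt_succ_iff.1 (Finset.mem_range.1 ha))
    omega
  rw [← doubleCosetOperator_diagonalGL_primePow_succ k hp]
  congr 2
  funext i
  congr 1
  fin_cases i
  · rfl
  · simp only [Fin.mk_one, Matrix.cons_val_one, Matrix.cons_val_fin_one]
    rw [show m + 2 - (a + 1) = m - a + 1 by omega]

end GL2

end heckeAlgebra

end Literature.NumberTheory.Automorphic
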